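import Mathlib
import Literature.NumberTheory.Transcendental.BlochWignerDilogarithm
import Literature.NumberTheory.Transcendental.BlochWignerDilogarithmProofs
import HarnessLib

/-!
# Parity of the Bloch–Wigner regulator under the embeddings of a one-complex-place field

Stub `stub_regulatorParity` of the line `kummer-clausen-linearisation` (reshape c1, Borel
carve-out) for the crux `ZagierDilogarithmConjecture` (stmt-KontsevichZagierPeriods-10550, route
`HyperbolicBloch`).

Write `D := blochWignerDilog`. Let `K ⊂ ℂ` be a conjugation-closed subfield all of whose ring
embeddings `σ : K → ℂ` are the inclusion, its complex conjugate, or real-valued (a field with one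
complex place, e.g. an imaginary quadratic field), and let `zᵢ ∈ K` with `Im zᵢ > 0`,
`Σ nᵢ D(zᵢ) = 0`. Then the element `ξ = Σ nᵢ ([zᵢ] − [z̄ᵢ])` has vanishing `D`-sum under EVERY
embedding `σ`:

* `σ` = inclusion: `Σ nᵢ (D(zᵢ) − D(z̄ᵢ)) = 2 Σ nᵢ D(zᵢ) = 0`, by `D(z̄) = −D(z)`
  (`blochWignerDilog_conj'`, Neumann 1998 Thm. 2.4);
* `σ` = conjugate of the inclusion: `Σ nᵢ (D(z̄ᵢ) − D(zᵢ)) = −2 Σ nᵢ D(zᵢ) = 0`;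
* `σ` real-valued: every `D(σ x) = 0` since `D` vanishes on `ℝ` (`blochWignerDilog_of_im_eq_zero`,
  a flat simplex has volume `0`).

This is the "zero volume at every place" input of Borel's regulator theorem
(Dupont 2001, Thm. 10.24 a) for the Borel slice `stub_borelSlice`.
-/

noncomputable section

open scoped BigOperators ComplexConjugate
open Literature.NumberTheory.Transcendental

namespace Summit.KontsevichZagierPeriods.HyperbolicBloch.ZagierDilogarithm

/-- `D(z) − D(z̄) = 2 D(z)` for every `z ∈ ℂ` (`D(z̄) = −D(z)`).
[cite: Neumann1998, §2, Thm. 2.4 and p. 7] -/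
theorem regulatorParity_sub_conj (z : ℂ) :
    blochWignerDilog z - blochWignerDilog (conj z) = 2 * blochWignerDilog z := by
  rw [blochWignerDilog_conj']
  ring

/-- `D(z̄) − D(z̄̄) = −2 D(z)` for every `z ∈ ℂ` (`D(z̄) = −D(z)`, `z̄̄ = z`).
[cite: Neumann1998, §2, Thm. 2.4 and p. 7] -/
theorem regulatorParity_conj_sub_conj_conj (z : ℂ) :
    blochWignerDilog (conj z) - blochWignerDilog (conj (conj z)) = -(2 * blochWignerDilog z) := by
  rw [Complex.conj_conj, blochWignerDilog_conj']
  ring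

/-- **Parity of the regulator under the embeddings of a one-complex-place field.**
For a conjugation-closed subfield `K ⊂ ℂ` all of whose embeddings are the inclusion, its conjugate,
or real-valued, and `zᵢ ∈ K ∩ ℍ⁺` with `Σ nᵢ D(zᵢ) = 0`, the element `ξ = Σ nᵢ ([zᵢ] − [z̄ᵢ])` has
`Σ nᵢ (D(σ zᵢ) − D(σ z̄ᵢ)) = 0` for EVERY embedding `σ : K → ℂ`: for the inclusion the sum is
`2 Σ nᵢ D(zᵢ)`, for its conjugate `−2 Σ nᵢ D(zᵢ)` (`D(z̄) = −D(z)`), and for a real-valued `σ` every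
term vanishes (`D|_ℝ = 0`). [cite: Neumann1998, §2, Thm. 2.4 and p. 7] -/
theorem stub_regulatorParity :
    ∀ (K : IntermediateField ℚ ℂ) (hKc : ∀ x : ℂ, x ∈ K → (starRingEnd ℂ) x ∈ K),
      (∀ σ : K →+* ℂ, (∀ x : K, σ x = (x : ℂ)) ∨ (∀ x : K, σ x = (starRingEnd ℂ) (x : ℂ)) ∨
        (∀ x : K, (σ x).im = 0)) →
      ∀ (k : ℕ) (z : Fin k → ℂ) (n : Fin k → ℤ) (hz : ∀ i, z i ∈ K), (∀ i, 0 < (z i).im) →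
        ∑ i, (n i : ℝ) * blochWignerDilog (z i) = 0 →
          ∀ σ : K →+* ℂ, ∑ i, (n i : ℝ) * (blochWignerDilog (σ ⟨z i, hz i⟩) -
            blochWignerDilog (σ ⟨(starRingEnd ℂ) (z i), hKc (z i) (hz i)⟩)) = 0 := by
  intro K hKc hK k z n hz _ hrel σ
  rcases hK σ with h | h | h
  · -- `σ` is the inclusion `K ⊂ ℂ`
    have hterm : ∀ i, (n i : ℝ) * (blochWignerDilog (σ ⟨z i, hz i⟩) -
        blochWignerDilog (σ ⟨(starRingEnd ℂ) (z i), hKc (z i) (hz i)⟩)) =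
        2 * ((n i : ℝ) * blochWignerDilog (z i)) := by
      intro i
      have e₁ : σ ⟨z i, hz i⟩ = z i := h _
      have e₂ : σ ⟨(starRingEnd ℂ) (z i), hKc (z i) (hz i)⟩ = conj (z i) := h _
      rw [e₁, e₂, regulatorParity_sub_conj]
      ring
    rw [Finset.sum_congr rfl fun i _ => hterm i, ← Finset.mul_sum, hrel, mul_zero]
  · -- `σ` is the complex conjugate of the inclusion
    have hterm : ∀ i, (n i : ℝ) * (blochWignerDilog (σ ⟨z i, hz i⟩) -
        blochWignerDilog (σ ⟨(starRingEnd ℂ) (z i), hKc (z i) (hz i)⟩)) =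
        -2 * ((n i : ℝ) * blochWignerDilog (z i)) := by
      intro i
      have e₁ : σ ⟨z i, hz i⟩ = conj (z i) := h _
      have e₂ : σ ⟨(starRingEnd ℂ) (z i), hKc (z i) (hz i)⟩ = conj (conj (z i)) := h _
      rw [e₁, e₂, regulatorParity_conj_sub_conj_conj]
      ring
    rw [Finset.sum_congr rfl fun i _ => hterm i, ← Finset.mul_sum, hrel, mul_zero]
  · -- `σ` is real-valued: every term vanishes
    refine Finset.sum_eq_zero fun i _ => ?_
    rw [blochWignerDilog_of_im_eq_zero (h _), blochWignerDilog_of_im_eq_zero (h _), sub_zero,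
      mul_zero]

end Summit.KontsevichZagierPeriods.HyperbolicBloch.ZagierDilogarithm

end
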